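import Summits.QuantumFields.YangMills.Theorems.BalabanLadderIRTwistedSlabOrbitLaplace
import Summits.QuantumFields.YangMills.Theorems.BalabanLadderIRTwistedSlabProjectionLoadBearing
import Literature.Analysis.Asymptotics.LaplaceMethodOrbitConstant
import Literature.Analysis.Asymptotics.LaplaceMethodCompactGroup
import HarnessLib

/-!
# The orbit constants of the twisted slab in CLOSED FORM: the Haar chart of the gauge group in the exponential gauge chart (lit-4 L25), the stabiliser order
# `|Z_N| = N`, and ONE CALL of lit-4 L24 `tendsto_laplaceMethod_sum_orbits_closedForm` — no window integrals left in the tree-level limit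

HELPER toward stub **T1** `TwistedSlabAnchor` (LINE `twisted-slab-continuity`, crux `IRcof` stmt-QuantumFields-26930, census row 43;
LEAD prover ym-ir-line-tsc-p1 g4; `--supports` the crux, `--as helper`).  Sequel of K23 `…TwistedSlabOrbitLaplace`; consumes lit-4's L24
`Literature/Analysis/Asymptotics/LaplaceMethodOrbitConstant` and L25 (`LaplaceMethodCompactGroup.exists_haarChart_expChart_frame`) BY NAME.
Norm scope `Matrix.Norms.L2Operator` (B89's charts); conclusions are measure ∕ limit statements.
* §1 ★★ `exists_haarChart_expGauge` — THE HAAR CHART OF THE GAUGE GROUP: for any frame `T_M : M ≃L suFields` and any Haar measure `ν` on `𝒢` there are an open `U ∋ 0` in `M`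
  and a continuous density `hd ≥ 0` with `hd 0 > 0` such that `e = expGauge ∘ T_M` is injective on `U` and `ν|_{e(U)} = e_*((hd · vol_M)|_U)` (lit-4 L25).
* §2 `orderOf_suCenter` (`= N` for a unit `k`, g0 `suCenter_pow_ne_one`), ★ `ncard_constCenterGauge` (`|S| = N`).
* §3 ★★★ `tendsto_laplace_sum_orbits_twistedExponent_closedForm`: K23's limit with the orbit constants in CLOSED FORM
  `(2π)^{m/2} ν(𝒢) J_{ij}(0) ∕ (N · hd(0) · √det A_{ij})` — ONE CALL of L24 with K23's inputs + §1 + §2.  Proof file: theorems only, no definitions.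
NOT here (honest scope): the product form of the window constants `J(0)`, `hd(0)` (B89 `pi_haar_restrict_image_eq_smul`) and the Gaussian determinants (K8) = THE NUMBER;
anything uniform in `β` (M3) or in `L, t` (M4); T1-box 0∕1, T1 proper 0∕1.

HONEST FRAMING: the classical (`β → ∞`) limit at ONE fixed box; nothing here bears on `IRcof`, `IR`, or the Yang–Mills mass gap (Clay: NOT proved); R4 =
`BalabanLadder.UV` only.  References: S. Helgason (2000) Ch. I §1 Thm 1.14 (13); E. Hasenpflug, D. Rudolf, B. Sprungk (2024) App. 4.1 Thm 16 ∕ Remark 17; C.-R. Hwang (1980).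
-/

set_option autoImplicit false

noncomputable section

open scoped Matrix Matrix.Norms.L2Operator Topology ENNReal InnerProductSpace Pointwise
open MeasureTheory Filter NormedSpace Set Metric Module
open Literature.MathematicalPhysics.QuantumFieldTheory Literature.MathematicalPhysics.QuantumLattice
open Literature.MathematicalPhysics.QuantumFieldTheory.Balaban1983to89
open Literature.MathematicalPhysics.QuantumFieldTheory.Balaban1983to89.HaarExponentialChart
open Literature.MathematicalPhysics.QuantumFieldTheory.Balaban1983to89.LogChartProduct
open Literature.Analysis.Asymptotics Literature.MeasureTheory.Group

namespace Summit.QuantumFields.YangMills.Cruxes.IRcof.TwistedSlab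

variable {N : ℕ} [NeZero N]

/-! ## §1 The Haar chart of the gauge group in the exponential gauge chart -/

section HaarChart

variable {n₀ n₁ n₂ n₃ : ℕ}
variable {M : Type*} [NormedAddCommGroup M] [InnerProductSpace ℝ M] [FiniteDimensional ℝ M] [MeasurableSpace M] [BorelSpace M]

/-- ★★ **THE HAAR CHART OF THE GAUGE GROUP** (lit-4 L25 `exists_haarChart_expChart_frame` for B89's product chart of `SU(N)^{sites}`, read through the identity frame `suFields ≃ 𝔤^{sites}` and `expChart_pi_apply`: `Θ^{sites} ∘ frame = expGauge`): for every frame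
`T_M : M ≃L suFields` and every Haar measure `ν` on `𝒢` there are an open `U ∋ 0` and a continuous `hd ≥ 0` with `hd 0 > 0`, `e = expGauge ∘ T_M` injective on `U`, and
`ν|_{e(U)} = e_*((hd · vol_M)|_U)`. [cite: Helgason2000, Ch. I §1 Thm 1.14 (13) p. 96] [cite: Balaban1985UV3, p. 260] -/
theorem exists_haarChart_expGauge (T_M : M ≃L[ℝ] suFields N n₀ n₁ n₂ n₃)
    (ν : Measure (FinTorusSite n₀ n₁ n₂ n₃ → Matrix.specialUnitaryGroup (Fin N) ℂ)) [ν.IsHaarMeasure] :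
    ∃ (U : Set M) (hd : M → ℝ), IsOpen U ∧ (0 : M) ∈ U ∧ InjOn (fun z : M => expGauge (T_M z)) U ∧ Continuous hd ∧ (∀ z, 0 ≤ hd z) ∧ 0 < hd 0 ∧
      ν.restrict ((fun z : M => expGauge (T_M z)) '' U) =
        (((volume : Measure M).restrict U).withDensity fun z => ENNReal.ofReal (hd z)).map (fun z : M => expGauge (T_M z)) := by
  letI : MeasurableSpace (piLogChart (specialUnitaryLogChart (Fin N)) (FinTorusSite n₀ n₁ n₂ n₃)).lie := borel _
  haveI : BorelSpace (piLogChart (specialUnitaryLogChart (Fin N)) (FinTorusSite n₀ n₁ n₂ n₃)).lie := ⟨rfl⟩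
  haveI : FiniteDimensional ℝ (piLogChart (specialUnitaryLogChart (Fin N)) (FinTorusSite n₀ n₁ n₂ n₃)).lie := finiteDimensional_piLogChart_lie _ _
  -- the identity `suFields ≃ 𝔤^{sites}` as a frame
  let F : suFields N n₀ n₁ n₂ n₃ ≃ₗ[ℝ] (piLogChart (specialUnitaryLogChart (Fin N)) (FinTorusSite n₀ n₁ n₂ n₃)).lie :=
    { toFun := fun φ => ⟨(φ : FinTorusSite n₀ n₁ n₂ n₃ → Matrix (Fin N) (Fin N) ℂ), (mem_piLogChart_lie _ _).2 fun x =>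
        mem_specialUnitaryLogChart_lie.2 (by rw [Matrix.star_eq_conjTranspose]; exact φ.2 x)⟩
      invFun := fun X => ⟨(X : FinTorusSite n₀ n₁ n₂ n₃ → Matrix (Fin N) (Fin N) ℂ), mem_suFields.2 fun x => by
        have h := mem_specialUnitaryLogChart_lie.1 ((mem_piLogChart_lie _ _).1 X.2 x)
        rwa [Matrix.star_eq_conjTranspose] at h⟩
      map_add' := fun _ _ => rfl
      map_smul' := fun _ _ => rfl
      left_inv := fun _ => rfl
      right_inv := fun _ => rfl }
  set e : M ≃L[ℝ] (piLogChart (specialUnitaryLogChart (Fin N)) (FinTorusSite n₀ n₁ n₂ n₃)).lie := T_M.trans F.toContinuousLinearEquiv with he_def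
  -- B89's product chart through the frame IS the exponential gauge chart
  have he : (fun v : M => (isChartRep_pi (FinTorusSite n₀ n₁ n₂ n₃) (isChartRep_specialUnitaryGroup (n := Fin N))).expChart (e v)) =
      fun z : M => expGauge (T_M z) := by
    funext v; funext x
    rw [expChart_pi_apply _ (isChartRep_specialUnitaryGroup (n := Fin N))]
    apply fundamentalRep_injective (Fin N)
    rw [(isChartRep_specialUnitaryGroup (n := Fin N)).rho_expChart, fundamentalRep_apply, coe_expGauge_apply, coe_lieApply]
    rfl
  obtain ⟨U, hd, hUo, h0U, hinj, hdc, hd0, hd00, -, hchart⟩ := exists_haarChart_expChart_frame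
    (isChartRep_pi (FinTorusSite n₀ n₁ n₂ n₃) (isChartRep_specialUnitaryGroup (n := Fin N)))
    (lie_adStable_pi (specialUnitaryLogChart (Fin N)) (FinTorusSite n₀ n₁ n₂ n₃) (lie_adStable_specialUnitaryGroup (n := Fin N))) ν e
  rw [he] at hinj hchart
  exact ⟨U, hd, hUo, h0U, hinj, hdc, hd0, hd00, hchart⟩

end HaarChart

/-! ## §2 The stabiliser order `|Z_N| = N` -/

section Order

variable {n₀ n₁ n₂ n₃ : ℕ}

/-- `ω^k·1 ∈ SU(N)` has order exactly `N` when `k` is a unit (g0 `suCenter_pow_ne_one`). [folklore] -/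
theorem orderOf_suCenter {k : ZMod N} (hk : IsUnit k) : orderOf (suCenter N k : Matrix.specialUnitaryGroup (Fin N) ℂ) = N := by
  refine (orderOf_eq_iff (Nat.pos_of_ne_zero (NeZero.ne N))).2 ⟨coe_suCenter_pow_card k, fun j hjN hj => suCenter_pow_ne_one hk hj hjN⟩

/-- ★ **`|S| = N`**: the constant gauge maps valued in `⟨ω^k·1⟩` number exactly `N` (sites non-empty). [cite: Gonzalezarroyo1998, §4.2] -/
theorem ncard_constCenterGauge {k : ZMod N} (hk : IsUnit k) [Nonempty (FinTorusSite n₀ n₁ n₂ n₃)] :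
    ({g : FinTorusSite n₀ n₁ n₂ n₃ → Matrix.specialUnitaryGroup (Fin N) ℂ |
      ∃ c ∈ Subgroup.zpowers (suCenter N k : Matrix.specialUnitaryGroup (Fin N) ℂ), g = fun _ => c}).ncard = N := by
  have heq : {g : FinTorusSite n₀ n₁ n₂ n₃ → Matrix.specialUnitaryGroup (Fin N) ℂ |
      ∃ c ∈ Subgroup.zpowers (suCenter N k : Matrix.specialUnitaryGroup (Fin N) ℂ), g = fun _ => c} =
      (fun c : Matrix.specialUnitaryGroup (Fin N) ℂ => fun _ : FinTorusSite n₀ n₁ n₂ n₃ => c) ''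
        (Subgroup.zpowers (suCenter N k : Matrix.specialUnitaryGroup (Fin N) ℂ) : Set (Matrix.specialUnitaryGroup (Fin N) ℂ)) := by
    ext g
    simp only [mem_setOf_eq, mem_image, SetLike.mem_coe]
    constructor
    · rintro ⟨c, hc, rfl⟩; exact ⟨c, hc, rfl⟩
    · rintro ⟨c, hc, rfl⟩; exact ⟨c, hc, rfl⟩
  have hinj : Function.Injective fun c : Matrix.specialUnitaryGroup (Fin N) ℂ => fun _ : FinTorusSite n₀ n₁ n₂ n₃ => c :=
    fun c c' h => congrFun h (Classical.arbitrary _)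
  rw [heq, Set.ncard_image_of_injective _ hinj, ← Nat.card_coe_set_eq, SetLike.coe_sort_coe, Nat.card_zpowers, orderOf_suCenter hk]

end Order

section Main

variable {m m₂ m₃ : ℕ}
variable {M : Type*} [NormedAddCommGroup M] [InnerProductSpace ℝ M] [FiniteDimensional ℝ M] [MeasurableSpace M] [BorelSpace M]
variable {V : Type*} [NormedAddCommGroup V] [InnerProductSpace ℝ V] [FiniteDimensional ℝ V] [MeasurableSpace V] [BorelSpace V]

/-! ## §3 The `N²`-orbit Laplace asymptotics with CLOSED-FORM orbit constants -/

/-- ★★★ **LAPLACE ON THE `N²` CRITICAL ORBITS, CLOSED-FORM CONSTANTS** (lit-4 L24 `tendsto_laplaceMethod_sum_orbits_closedForm` fed by name): in the setting of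
K23 `tendsto_laplace_sum_orbits_twistedExponent` there is a constant `h₀ > 0` — the density at `0` of the Haar probability of the gauge group `𝒢 = SU(N)^{sites}` in the
exponential gauge chart `e = expGauge ∘ T_M` w.r.t. Lebesgue measure on `M` — such that
`β^{dim V/2} ∫ e^{−β·twistedExponent k} φ dHaar ⟶ Σ_{(i,j)} (2π)^{dim V/2} · ν(𝒢) · J_{ij}(0) ∕ (N · h₀) · φ(ladder_{ij}) ∕ √det A_{ij}`
(`J_{ij}(0)` = K17's fibred chart density AT THE ORIGIN, `A_{ij}` = K19's slice Hessian; no window integrals left; `|Z_N| = N`).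
[cite: HasenpflugRudolfSprungk2024, §3.4 and App. 4.1 Thm 16 ∕ Remark 17] [cite: Hwang1980, main theorem] [cite: Helgason2000, Ch. I §1 Thm 1.14 (13) p. 96] -/
theorem tendsto_laplace_sum_orbits_twistedExponent_closedForm {k : ZMod N} (hk : IsUnit k) {A B : Matrix.specialUnitaryGroup (Fin N) ℂ}
    (hAB : B * A * B⁻¹ * A⁻¹ = (suCenter N k : Matrix.specialUnitaryGroup (Fin N) ℂ)) (hNm : 2 ≤ N * (m + 1))
    (T_M : M ≃L[ℝ] suFields N (m + 1) (m + 1) (m₂ + 1) (m₃ + 1))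
    (T_V : ∀ p : ZMod N × ZMod N, V ≃L[ℝ] realCoulombSlice (ladderField (n₀ := m + 1) (n₁ := m + 1) (n₂ := m₂ + 1) (n₃ := m₃ + 1)
      ![(A : Matrix (Fin N) (Fin N) ℂ), (B : Matrix (Fin N) (Fin N) ℂ), centerPhase N p.1 • (1 : Matrix (Fin N) (Fin N) ℂ), centerPhase N p.2 • (1 : Matrix (Fin N) (Fin N) ℂ)]))
    {φ : (FinTorusSite (m + 1) (m + 1) (m₂ + 1) (m₃ + 1) × Fin 4 → Matrix.specialUnitaryGroup (Fin N) ℂ) → ℝ} (hφ : Continuous φ)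
    (hφinv : ∀ (g : FinTorusSite (m + 1) (m + 1) (m₂ + 1) (m₃ + 1) → Matrix.specialUnitaryGroup (Fin N) ℂ) U, φ (gaugeAct g U) = φ U) :
    ∃ h₀ : ℝ, 0 < h₀ ∧
      Tendsto (fun β : ℝ => β ^ ((finrank ℝ V : ℝ) / 2) *
          ∫ U, Real.exp (-β * twistedExponent k U) * φ U ∂(Measure.pi fun _ => haarProbability (Matrix.specialUnitaryGroup (Fin N) ℂ))) atTop
        (𝓝 (∑ p : ZMod N × ZMod N, (2 * Real.pi) ^ ((finrank ℝ V : ℝ) / 2) *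
          ((Measure.pi fun _ : FinTorusSite (m + 1) (m + 1) (m₂ + 1) (m₃ + 1) => haarProbability (Matrix.specialUnitaryGroup (Fin N) ℂ)).real univ *
            (fibredChartDensity (ladderFieldPair_mem_specialUnitaryGroup A B p.1 p.2)
                (slicePsiSuDeriv (Matrix.specialUnitaryGroup_le_unitaryGroup A.2) (Matrix.specialUnitaryGroup_le_unitaryGroup B.2)
                  (isPrimitiveRoot_star_centerPhase (N := N) hk) (coe_mul_eq_smul_of_commutator_eq hAB) hNm (ladderFieldPair_mem_specialUnitaryGroup A B p.1 p.2))
                (prodFrame T_M (T_V p)) (Measure.pi fun _ => haarProbability (Matrix.specialUnitaryGroup (Fin N) ℂ)) 0 / ((N : ℝ) * h₀) *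
            φ (ladderConfig ![A, B, (suCenter N p.1 : Matrix.specialUnitaryGroup (Fin N) ℂ), (suCenter N p.2 : Matrix.specialUnitaryGroup (Fin N) ℂ)]) /
            Real.sqrt (LinearMap.det (sliceHessian (fun e => (⟨ladderField (n₀ := m + 1) (n₁ := m + 1) (n₂ := m₂ + 1) (n₃ := m₃ + 1)
              ![(A : Matrix (Fin N) (Fin N) ℂ), (B : Matrix (Fin N) (Fin N) ℂ), centerPhase N p.1 • (1 : Matrix (Fin N) (Fin N) ℂ),
                centerPhase N p.2 • (1 : Matrix (Fin N) (Fin N) ℂ)] e, ladderFieldPair_mem_specialUnitaryGroup A B p.1 p.2 e⟩ : Matrix.specialUnitaryGroup (Fin N) ℂ))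
              (T_V p) k)))))) := by
  classical
  have hAu : (A : Matrix (Fin N) (Fin N) ℂ) ∈ Matrix.unitaryGroup (Fin N) ℂ := Matrix.specialUnitaryGroup_le_unitaryGroup A.2
  have hBu : (B : Matrix (Fin N) (Fin N) ℂ) ∈ Matrix.unitaryGroup (Fin N) ℂ := Matrix.specialUnitaryGroup_le_unitaryGroup B.2
  have hω := isPrimitiveRoot_star_centerPhase (N := N) hk
  have hAB' := coe_mul_eq_smul_of_commutator_eq hAB
  have hL : ∀ p : ZMod N × ZMod N, ∀ e : FinTorusSite (m + 1) (m + 1) (m₂ + 1) (m₃ + 1) × Fin 4,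
      ladderField ![(A : Matrix (Fin N) (Fin N) ℂ), (B : Matrix (Fin N) (Fin N) ℂ), centerPhase N p.1 • (1 : Matrix (Fin N) (Fin N) ℂ),
        centerPhase N p.2 • (1 : Matrix (Fin N) (Fin N) ℂ)] e ∈ Matrix.specialUnitaryGroup (Fin N) ℂ :=
    fun p => ladderFieldPair_mem_specialUnitaryGroup A B p.1 p.2
  -- the chart data of every orbit (K20a)
  choose r hr hinj hJc hmeas hchart using fun p : ZMod N × ZMod N =>
    exists_ball_prod_hloc_ladder (M := M) (V := V) hAu hBu hω hAB' hNm (hL p) (prodFrame T_M (T_V p))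
      (Measure.pi fun _ => haarProbability (Matrix.specialUnitaryGroup (Fin N) ℂ))
  -- the chart is open at the origin (K22)
  have hΘ'𝓝 : ∀ p : ZMod N × ZMod N, 𝓝 ((fun (p : ZMod N × ZMod N) (y : V) => sliceCfg (hL p) (T_V p y)) p 0) ≤
      map (fibredChartMap (hL p) (prodFrame T_M (T_V p))) (𝓝 0) := by
    intro p
    obtain ⟨W, -, hW0, hW⟩ := exists_isOpen_forall_nhds_le_map_fibredChartMap hAu hBu hω hAB' hNm (hL p) (prodFrame T_M (T_V p))
    have h := hW 0 hW0
    rwa [fibredChartMap_prodFrame_zero] at h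
  -- the box `closedBall (r/2) × {0}` inside the product window
  have hρW : ∀ p : ZMod N × ZMod N, closedBall (0 : M) (r p / 2) ×ˢ {(0 : V)} ⊆ ball (0 : M) (r p) ×ˢ ball (0 : V) (r p) := by
    rintro p ⟨z, y⟩ ⟨hz, hy⟩
    rw [mem_singleton_iff] at hy
    subst hy
    exact ⟨closedBall_subset_ball (by linarith [hr p]) hz, mem_ball_self (hr p)⟩
  -- stabiliser
  have hstab : ∀ (p : ZMod N × ZMod N) (g : FinTorusSite (m + 1) (m + 1) (m₂ + 1) (m₃ + 1) → Matrix.specialUnitaryGroup (Fin N) ℂ),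
      gaugeAct g ((fun (p : ZMod N × ZMod N) (y : V) => sliceCfg (hL p) (T_V p y)) p 0) =
        (fun (p : ZMod N × ZMod N) (y : V) => sliceCfg (hL p) (T_V p y)) p 0 →
      g ∈ (fun _ : ZMod N × ZMod N => {g : FinTorusSite (m + 1) (m + 1) (m₂ + 1) (m₃ + 1) → Matrix.specialUnitaryGroup (Fin N) ℂ |
        ∃ c ∈ Subgroup.zpowers (suCenter N k : Matrix.specialUnitaryGroup (Fin N) ℂ), g = fun _ => c}) p := by
    intro p g hg
    simp only [map_zero, sliceCfg_zero_eq_ladderConfig] at hg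
    exact mem_constCenterGauge_of_gaugeAct_ladder_eq hk hAB p.1 p.2 g hg
  -- the Peano expansion along the transversal (K19)
  have hS2 : ∀ p : ZMod N × ZMod N, (fun y : V => twistedExponent k ((fun (p : ZMod N × ZMod N) (y : V) => sliceCfg (hL p) (T_V p y)) p y) -
      twistedExponent k ((fun (p : ZMod N × ZMod N) (y : V) => sliceCfg (hL p) (T_V p y)) p 0) -
      (1 / 2) * ⟪sliceHessian (fun e => (⟨ladderField (n₀ := m + 1) (n₁ := m + 1) (n₂ := m₂ + 1) (n₃ := m₃ + 1)
        ![(A : Matrix (Fin N) (Fin N) ℂ), (B : Matrix (Fin N) (Fin N) ℂ), centerPhase N p.1 • (1 : Matrix (Fin N) (Fin N) ℂ),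
          centerPhase N p.2 • (1 : Matrix (Fin N) (Fin N) ℂ)] e, hL p e⟩ : Matrix.specialUnitaryGroup (Fin N) ℂ)) (T_V p) k y, y⟫_ℝ) =o[𝓝 0]
      fun y => ‖y‖ ^ 2 := by
    intro p
    have h := isLittleO_slicePhase_taylor_two (fun e => (⟨ladderField (n₀ := m + 1) (n₁ := m + 1) (n₂ := m₂ + 1) (n₃ := m₃ + 1)
      ![(A : Matrix (Fin N) (Fin N) ℂ), (B : Matrix (Fin N) (Fin N) ℂ), centerPhase N p.1 • (1 : Matrix (Fin N) (Fin N) ℂ),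
        centerPhase N p.2 • (1 : Matrix (Fin N) (Fin N) ℂ)] e, hL p e⟩ : Matrix.specialUnitaryGroup (Fin N) ℂ)) (T_V p) k
      (twistedExponent_mk_ladderFieldPair hk hAB p.1 p.2 (hL p))
    refine h.congr' (Eventually.of_forall fun y => ?_) EventuallyEq.rfl
    simp only [twistedExponent_sliceCfg_eq_slicePhase]
  -- values at the vacua, the zero set, distinct orbits (K9, K2)
  have hf₀ : ∀ p : ZMod N × ZMod N, twistedExponent k ((fun (p : ZMod N × ZMod N) (y : V) => sliceCfg (hL p) (T_V p y)) p 0) = 0 := by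
    intro p
    simp only [map_zero, sliceCfg_zero_eq_ladderConfig]
    exact twistedExponent_ladderConfig_pair hk hAB p.1 p.2
  have hzero : ∀ U : FinTorusSite (m + 1) (m + 1) (m₂ + 1) (m₃ + 1) × Fin 4 → Matrix.specialUnitaryGroup (Fin N) ℂ, twistedExponent k U = 0 →
      ∃ (p : ZMod N × ZMod N) (g : FinTorusSite (m + 1) (m + 1) (m₂ + 1) (m₃ + 1) → Matrix.specialUnitaryGroup (Fin N) ℂ),
        gaugeAct g ((fun (p : ZMod N × ZMod N) (y : V) => sliceCfg (hL p) (T_V p y)) p 0) = U := by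
    intro U hU
    obtain ⟨g, i, j, rfl⟩ := (twistedExponent_eq_zero_iff hk hAB U).1 hU
    exact ⟨(i, j), g, by simp only [map_zero, sliceCfg_zero_eq_ladderConfig]⟩
  have hdist : ∀ p q : ZMod N × ZMod N, p ≠ q → ∀ g : FinTorusSite (m + 1) (m + 1) (m₂ + 1) (m₃ + 1) → Matrix.specialUnitaryGroup (Fin N) ℂ,
      gaugeAct g ((fun (p : ZMod N × ZMod N) (y : V) => sliceCfg (hL p) (T_V p y)) p 0) ≠
        (fun (p : ZMod N × ZMod N) (y : V) => sliceCfg (hL p) (T_V p y)) q 0 := by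
    intro p q hpq g h
    apply hpq
    simp only [map_zero, sliceCfg_zero_eq_ladderConfig] at h
    have h' : gaugeAct g (ladderConfig ![A, B, (suCenter N p.1 : Matrix.specialUnitaryGroup (Fin N) ℂ), (suCenter N p.2 : Matrix.specialUnitaryGroup (Fin N) ℂ)]) =
        gaugeAct 1 (ladderConfig ![A, B, (suCenter N q.1 : Matrix.specialUnitaryGroup (Fin N) ℂ), (suCenter N q.2 : Matrix.specialUnitaryGroup (Fin N) ℂ)]) := by
      rw [gaugeAct_one]; exact h
    obtain ⟨hi, hj, -⟩ := ladder_pair_labels_unique_specialUnitary hk hAB h'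
    exact Prod.ext (suCenter_coe_injective hi).symm (suCenter_coe_injective hj).symm
  have hfix : ∀ (p : ZMod N × ZMod N), ∀ s ∈ (fun _ : ZMod N × ZMod N => {g : FinTorusSite (m + 1) (m + 1) (m₂ + 1) (m₃ + 1) → Matrix.specialUnitaryGroup (Fin N) ℂ |
      ∃ c ∈ Subgroup.zpowers (suCenter N k : Matrix.specialUnitaryGroup (Fin N) ℂ), g = fun _ => c}) p, ∀ y : V,
      gaugeAct s ((fun (p : ZMod N × ZMod N) (y : V) => sliceCfg (hL p) (T_V p y)) p y) = (fun (p : ZMod N × ZMod N) (y : V) => sliceCfg (hL p) (T_V p y)) p y :=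
    fun p s hs y => gaugeAct_eq_self_of_mem_constCenterGauge hs _
  -- the Haar chart of the gauge group in the exponential gauge chart (lit-4 L25)
  obtain ⟨U, hd, hUo, h0U, hinjU, hdc, hh0', hh00, hhaar⟩ := exists_haarChart_expGauge T_M
    (Measure.pi fun _ : FinTorusSite (m + 1) (m + 1) (m₂ + 1) (m₃ + 1) => haarProbability (Matrix.specialUnitaryGroup (Fin N) ℂ))
  have hhc : ContinuousOn hd U := hdc.continuousOn
  have hh0 : ∀ z ∈ U, 0 ≤ hd z := fun z _ => hh0' z
  refine ⟨hd 0, hh00, ?_⟩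
  have hmain := tendsto_laplaceMethod_sum_orbits_closedForm (ι := ZMod N × ZMod N)
    (K := FinTorusSite (m + 1) (m + 1) (m₂ + 1) (m₃ + 1) → Matrix.specialUnitaryGroup (Fin N) ℂ)
    (X := FinTorusSite (m + 1) (m + 1) (m₂ + 1) (m₃ + 1) × Fin 4 → Matrix.specialUnitaryGroup (Fin N) ℂ) (Z := M) (V := V)
    (act := gaugeAct) (σ := fun (p : ZMod N × ZMod N) (y : V) => sliceCfg (hL p) (T_V p y)) (e := fun z : M => expGauge (T_M z))
    (Θ := fun (p : ZMod N × ZMod N) (q : (FinTorusSite (m + 1) (m + 1) (m₂ + 1) (m₃ + 1) → Matrix.specialUnitaryGroup (Fin N) ℂ) × V) =>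
      gaugeAct q.1 (sliceCfg (hL p) (T_V p q.2)))
    (Θ' := fun p : ZMod N × ZMod N => fibredChartMap (hL p) (prodFrame T_M (T_V p)))
    (S := fun _ : ZMod N × ZMod N => {g : FinTorusSite (m + 1) (m + 1) (m₂ + 1) (m₃ + 1) → Matrix.specialUnitaryGroup (Fin N) ℂ |
      ∃ c ∈ Subgroup.zpowers (suCenter N k : Matrix.specialUnitaryGroup (Fin N) ℂ), g = fun _ => c})
    (ν := Measure.pi fun _ : FinTorusSite (m + 1) (m + 1) (m₂ + 1) (m₃ + 1) => haarProbability (Matrix.specialUnitaryGroup (Fin N) ℂ))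
    (μ := Measure.pi fun _ : FinTorusSite (m + 1) (m + 1) (m₂ + 1) (m₃ + 1) × Fin 4 => haarProbability (Matrix.specialUnitaryGroup (Fin N) ℂ))
    (κ := (volume : Measure M))
    (W := fun p : ZMod N × ZMod N => ball (0 : M) (r p) ×ˢ ball (0 : V) (r p))
    (J := fun p : ZMod N × ZMod N => fibredChartDensity (hL p) (slicePsiSuDeriv hAu hBu hω hAB' hNm (hL p)) (prodFrame T_M (T_V p))
      (Measure.pi fun _ : FinTorusSite (m + 1) (m + 1) (m₂ + 1) (m₃ + 1) × Fin 4 => haarProbability (Matrix.specialUnitaryGroup (Fin N) ℂ)))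
    (ρ := fun p : ZMod N × ZMod N => r p / 2)
    (f := twistedExponent k) (φ := φ)
    (A := fun p : ZMod N × ZMod N => sliceHessian (fun e => (⟨ladderField (n₀ := m + 1) (n₁ := m + 1) (n₂ := m₂ + 1) (n₃ := m₃ + 1)
      ![(A : Matrix (Fin N) (Fin N) ℂ), (B : Matrix (Fin N) (Fin N) ℂ), centerPhase N p.1 • (1 : Matrix (Fin N) (Fin N) ℂ),
        centerPhase N p.2 • (1 : Matrix (Fin N) (Fin N) ℂ)] e, hL p e⟩ : Matrix.specialUnitaryGroup (Fin N) ℂ)) (T_V p) k)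
    (f₀ := 0)
    continuous_gaugeAct_uncurry (fun g g' U => gaugeAct_mul g g' U) (fun U => gaugeAct_one U)
    (fun g => measurePreserving_gaugeAct_of_isHaarMeasure g _)
    (fun p => (continuous_sliceCfg (hL p)).comp (T_V p).continuous) (continuous_expGauge.comp T_M.continuous)
    (by simp only [map_zero, expGauge_zero]) (nhds_one_le_map_expGauge_comp T_M)
    (fun p g y => rfl) (fun p z y => fibredChartMap_prodFrame (hL p) T_M (T_V p) z y) hΘ'𝓝
    (fun p => isOpen_ball.prod isOpen_ball) hinj hJc (fun p w _ => fibredChartDensity_nonneg (hL p) _ _ _ w) hchart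
    (fun p => half_pos (hr p)) hρW hstab hfix
    (continuous_twistedExponent k) hφ (fun g U => twistedExponent_gaugeAct k g U) hφinv
    (fun p => sliceHessian_isSymmetric (fun e => (⟨ladderField (n₀ := m + 1) (n₁ := m + 1) (n₂ := m₂ + 1) (n₃ := m₃ + 1) ![(A : Matrix (Fin N) (Fin N) ℂ), (B : Matrix (Fin N) (Fin N) ℂ), centerPhase N p.1 • (1 : Matrix (Fin N) (Fin N) ℂ), centerPhase N p.2 • (1 : Matrix (Fin N) (Fin N) ℂ)] e, hL p e⟩ : Matrix.specialUnitaryGroup (Fin N) ℂ)) (T_V p) k)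
    (fun p y hy => sliceHessian_pos hk hNm _ (twistedExponent_mk_ladderFieldPair hk hAB p.1 p.2 (hL p)) (T_V p) hy)
    hS2 hf₀ (fun U => twistedExponent_nonneg k U) hzero hdist (fun _ => finite_constCenterGauge k) hUo h0U hinjU hhc hh0 hh00 hhaar
  haveI : Nonempty (FinTorusSite (m + 1) (m + 1) (m₂ + 1) (m₃ + 1)) := ⟨((0 : Fin (m + 1)), (0 : Fin (m + 1)), (0 : Fin (m₂ + 1)), (0 : Fin (m₃ + 1)))⟩
  simp only [sub_zero, map_zero, sliceCfg_zero_eq_ladderConfig, ncard_constCenterGauge hk] at hmain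
  exact hmain

end Main

end Summit.QuantumFields.YangMills.Cruxes.IRcof.TwistedSlab

end
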